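import Summits.CriticalPhenomena.PercolationContinuityZ3.Theorems.Transplant.SkelLinkedFace
import Summits.CriticalPhenomena.PercolationContinuityZ3.Theorems.Transplant.KNLevelsEquivariance
import HarnessLib

/-!
# L5.6a + L5.14 of the general node (`HOME/SHEAR-SCOPE.md` §3.9): Kozma–Nitzan's STEP I over a planar skeleton — the scales (inner sizes
# `msel t`, planar threshold `M₀`) at which the uniqueness zone and the Lemma-9 links of the fat prisms hold at every BASE vertex, and the
# θ-dependent inputs of the (D) construction as an explicit FINITE FAMILY of cylinder events (generic twins of
# `BoxProdZ2CubeInputs.exists_scales` and `BoxProdZ2ConcInputs`)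

builds on p205010 (kernel theorem, internal audit signed; external expert review pending) — nothing in this file uses p205010.
Lane `prim-bschramm`, seat `prim-bschramm-p3` (gen 4; claim L5.6/L5.14); helper file (`--supports stmt-CriticalPhenomena-4575 --as helper`).
The product indexed the inputs by `V₀ × S × Option (HOct 2)` (fibre representatives × scales × {zone, eight pieces}); here the index is
`Φ.types × S × Option (HOct 2)` — the same finite shape, so the (D) endgame "re-run at `q₀ < p`" transfers word for word.
* §1 **`exists_scales`** — `θ > 0`, a.s. uniqueness, `CylSubcritical`, `δ > 0`, `m₀` ⇒ `msel t ≥ m₀`, `M₀` with, for all `M ≥ M₀`, `t ∈ Φ.types`,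
  `g ∈ D₄`: `P_p(zone (fatSeq t) (msel t) M) > 1 − δ` (p2's `UniqZone` over `Λ := fatSeq t`) and
  `P_p(linkIn Λ^fat_M(t) Λ^fat_{msel t}(t) (macroPiece t M (ψ M) g)) > 1 − δ` (`SkelLinkedFace`);
* §2 `inputEvent`, `inputEdges`, `inputIndex`, `determinedBy_inputEvent`, **`exists_inputs_at_p`**, **`hstd_of_inputs`** (unpacking at a
  running parameter `q` into the `hstd` / `hlink` shapes of the kit lemmas);
* §3 `image_frame_fatSeq` / `image_frame_cylBallFin` / `image_frame_macroPiece` (a frame `t ↦ c` carries the fat prisms and macro pieces at `t`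
  onto those at `c` — the radii are centre-free), `real_inputs_frame`, **`exists_inputs_at_center`** (the standard estimates at EVERY vertex; the
  generic twin of `stepIV_inputs_at`'s frame step — the framed fat prism at a contact centre `c` IS `fatSeq c`).
[cite: KozmaNitzan2024, §4 p. 17 (Step I: the scales m, M), Lemma 7 (p. 15), Lemma 9 (p. 16)] [cite: GrimmettPercolation1999, §7.2]
-/

noncomputable section

open MeasureTheory

namespace Summit.CriticalPhenomena.PercolationContinuityZ3.Theorems

namespace Transplant

namespace Skel

open Literature.Probability.Percolation Literature.Probability.LatticeModels SimpleGraph KNLevels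
open Literature.Probability.Percolation.GM (HOct piece faceFin facePiece)
open scoped Classical

variable {V : Type} [DecidableEq V] {G : SimpleGraph V} [G.LocallyFinite] (Φ : PlanarSkeletonConc G)

/-! ## §1 Step I: the scales -/

/-- **Step I of Kozma–Nitzan's Lemma 10 over a planar skeleton** (the scales, uniform over the base vertices): for `δ > 0` and `m₀`
there are inner sizes `msel t ≥ m₀` (`t ∈ Φ.types`) and a planar threshold `M₀` such that for all `M ≥ M₀` the uniqueness zone of the fat
prisms `Λ^fat(t)` between sizes `msel t` and `M`, and the link from `Λ^fat_{msel t}(t)` to every macro quarter-piece of `Λ^fat_M(t)` inside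
`Λ^fat_M(t)`, each have probability `> 1 − δ`. Generic twin of `BoxProdZ2.exists_scales`.
[cite: KozmaNitzan2024, §4 p. 17 (Step I: the scales m, M), Lemma 7, Lemma 9] -/
theorem exists_scales [Countable V] {p : unitInterval} (hp1 : (p : ℝ) < 1) {z : V} (hθ : 0 < theta G z p)
    (hC : Φ.toPlanarSkeleton.CylSubcritical p) (hU : ∀ᵐ ω ∂(bondPercolation G p), numInfiniteClusters ω ≤ 1) {δ : ℝ} (hδ : 0 < δ)
    (m₀ : ℕ) :
    ∃ (msel : V → ℕ) (M₀ : ℕ), (∀ t ∈ Φ.types, m₀ ≤ msel t ∧ msel t < M₀) ∧ ∀ M, M₀ ≤ M → ∀ t ∈ Φ.types,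
      1 - δ < (bondPercolation G p).real (UniqZone.zone G (fatSeq Φ hC t) (msel t) M) ∧
      ∀ g : HOct 2, 1 - δ < (bondPercolation G p).real
        (linkIn (↑(fatSeq Φ hC t M)) (fatSeq Φ hC t (msel t)) (macroPiece Φ t M (fatRadius Φ hC M) g)) := by
  set k := Fintype.card (HOct 2) with hk
  have hk0 : k ≠ 0 := Fintype.card_ne_zero
  -- `η` with `η^{1/8} = δ/2`
  set η : ℝ := (δ / 2) ^ k with hη
  have hηpos : 0 < η := by positivity
  have hroot : η ^ ((k : ℝ)⁻¹) = δ / 2 := Real.pow_rpow_inv_natCast (by positivity) hk0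
  -- Lemma 9 at every base vertex
  have hL9 : ∀ t ∈ Φ.types, ∃ m : ℕ, m₀ ≤ m ∧ ∃ n₁ : ℕ, m < n₁ ∧ ∀ n, n₁ ≤ n → ∀ g : HOct 2,
      1 - η ^ ((k : ℝ)⁻¹) ≤ (bondPercolation G p).real
        (linkIn (↑(fatSeq Φ hC t n)) (fatSeq Φ hC t m) (macroPiece Φ t n (fatRadius Φ hC n) g)) :=
    fun t ht => exists_forall_prob_linkIn_macroPiece Φ hp1 hθ hC ht hηpos m₀
  choose! msel hmsel n₁ hn₁ hlink using hL9
  -- the uniqueness zone at every base vertex, for the chosen inner sizes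
  have hL7 : ∀ t ∈ Φ.types, ∃ n₀ : ℕ, ∀ n, n₀ ≤ n →
      1 - δ < (bondPercolation G p).real (UniqZone.zone G (fatSeq Φ hC t) (msel t) n) :=
    fun t ht => UniqZone.exists_forall_le_lt_real_zone p hU (fatSeq_nest Φ hC t) (fatSeq_monotone Φ hC t)
      (fatSeq_exhaust Φ hC ht) (msel t) hδ
  choose! n₀ hn₀ using hL7
  refine ⟨msel, Φ.types.sup n₁ + Φ.types.sup n₀ + 1, fun t ht => ⟨hmsel t ht, ?_⟩, fun M hM t ht => ⟨?_, fun g => ?_⟩⟩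
  · have := hn₁ t ht; have := Finset.le_sup (f := n₁) ht; omega
  · exact hn₀ t ht M (by have := Finset.le_sup (f := n₀) ht; omega)
  · have h := hlink t ht M (by have := Finset.le_sup (f := n₁) ht; omega) g
    rw [hroot] at h
    linarith

/-! ## §2 The θ-dependent inputs as a finite family of cylinder events -/

/-- **The input events**: the uniqueness zone (`none`) and the Lemma-9 links to the eight quarter-pieces (`some g`) of the fat prism of scale
`M` at the base vertex `t`. [cite: KozmaNitzan2024, §4 Lemma 7 (p. 15), Lemma 9 (p. 16)] -/
def inputEvent [Countable V] {p : unitInterval} (hC : Φ.toPlanarSkeleton.CylSubcritical p) (msel : V → ℕ) :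
    V × ℕ × Option (HOct 2) → Set (BondConfig V)
  | (t, M, none) => UniqZone.zone G (fatSeq Φ hC t) (msel t) M
  | (t, M, some g) => linkIn (↑(fatSeq Φ hC t M)) (fatSeq Φ hC t (msel t)) (macroPiece Φ t M (fatRadius Φ hC M) g)

/-- **The finite edge support** of an input event: the off-diagonal pairs inside the fat prism of its scale. [folklore] -/
def inputEdges [Countable V] {p : unitInterval} (hC : Φ.toPlanarSkeleton.CylSubcritical p) (i : V × ℕ × Option (HOct 2)) : Finset (Sym2 V) :=
  pairsF (fatSeq Φ hC i.1 i.2.1)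

omit [DecidableEq V] in
/-- **The finite index set** of the inputs at the base vertices and the planar scales `S`. [folklore] -/
def inputIndex (S : Finset ℕ) : Finset (V × ℕ × Option (HOct 2)) := Φ.types ×ˢ (S ×ˢ Finset.univ)

omit [DecidableEq V] in
/-- Membership in the index set. [folklore] -/
theorem mem_inputIndex_iff {S : Finset ℕ} {i : V × ℕ × Option (HOct 2)} : i ∈ inputIndex Φ S ↔ i.1 ∈ Φ.types ∧ i.2.1 ∈ S := by
  simp [inputIndex, Finset.mem_product]

/-- **Every input event is determined by the pairs inside its fat prism** (a cylinder event on finitely many coordinates). [folklore] -/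
theorem determinedBy_inputEvent [Countable V] {p : unitInterval} (hC : Φ.toPlanarSkeleton.CylSubcritical p) (msel : V → ℕ)
    (i : V × ℕ × Option (HOct 2)) : DeterminedBy (inputEvent Φ hC msel i) (↑(inputEdges Φ hC i) : Set (Sym2 V)) := by
  obtain ⟨t, M, og⟩ := i
  rcases og with _ | g
  · exact determinedBy_zone _ _ _ (by rw [inputEdges, coe_pairsF])
  · exact determinedBy_linkIn _ _ _ (by rw [inputEdges, coe_pairsF])

/-- **The inputs hold at `p`** (Step I packaged): `θ > 0`, a.s. uniqueness, `CylSubcritical`, `δ > 0` ⇒ inner sizes `msel t ≥ m₀` and a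
threshold `M₀ > msel t` such that for every finite set `S` of scales `≥ M₀` every input event over `Φ.types × S` has probability `> 1 − δ`.
[cite: KozmaNitzan2024, §4 p. 17 (Step I)] -/
theorem exists_inputs_at_p [Countable V] {p : unitInterval} (hp1 : (p : ℝ) < 1) {z : V} (hθ : 0 < theta G z p)
    (hC : Φ.toPlanarSkeleton.CylSubcritical p) (hU : ∀ᵐ ω ∂(bondPercolation G p), numInfiniteClusters ω ≤ 1) {δ : ℝ} (hδ : 0 < δ)
    (m₀ : ℕ) :
    ∃ (msel : V → ℕ) (M₀ : ℕ), (∀ t ∈ Φ.types, m₀ ≤ msel t ∧ msel t < M₀) ∧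
      ∀ S : Finset ℕ, (∀ M ∈ S, M₀ ≤ M) → ∀ i ∈ inputIndex Φ S, 1 - δ < (bondPercolation G p).real (inputEvent Φ hC msel i) := by
  obtain ⟨msel, M₀, hmsel, hstd⟩ := exists_scales Φ hp1 hθ hC hU hδ m₀
  refine ⟨msel, M₀, hmsel, fun S hS i hi => ?_⟩
  obtain ⟨t, M, og⟩ := i
  obtain ⟨ht, hM⟩ := (mem_inputIndex_iff Φ).1 hi
  obtain ⟨hzone, hlink⟩ := hstd M (hS M hM) t ht
  rcases og with _ | g
  · exact hzone
  · exact hlink g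

/-- **Unpacking the inputs at a running parameter `q`**: if every input event over `Φ.types × S` has probability `> 1 − δ` at `q`, then at
every scale `M ∈ S` and every base vertex the standard estimates hold at `q` (the `hstd` / `hlink` shapes of the kit lemmas). [folklore] -/
theorem hstd_of_inputs [Countable V] {p : unitInterval} (hC : Φ.toPlanarSkeleton.CylSubcritical p) (msel : V → ℕ) {S : Finset ℕ}
    {q : unitInterval} {δ : ℝ} (h : ∀ i ∈ inputIndex Φ S, 1 - δ < (bondPercolation G q).real (inputEvent Φ hC msel i)) {M : ℕ}
    (hM : M ∈ S) :
    ∀ t ∈ Φ.types,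
      1 - δ < (bondPercolation G q).real (UniqZone.zone G (fatSeq Φ hC t) (msel t) M) ∧
      ∀ g : HOct 2, 1 - δ < (bondPercolation G q).real
        (linkIn (↑(fatSeq Φ hC t M)) (fatSeq Φ hC t (msel t)) (macroPiece Φ t M (fatRadius Φ hC M) g)) :=
  fun t ht => ⟨h (t, M, none) ((mem_inputIndex_iff Φ).2 ⟨ht, hM⟩), fun g => h (t, M, some g) ((mem_inputIndex_iff Φ).2 ⟨ht, hM⟩)⟩

/-! ## §3 Inputs at ANY centre: the framed fat prisms are the fat prisms at the image vertex -/

section Frame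

variable {α : G ≃g G} {t c : V} (hαt : α t = c) (hφ : ∀ w, Φ.φ (α w) = Φ.φ w + (Φ.φ c - Φ.φ t))
include hαt hφ

/-- **A frame carries the fat prisms at `t` onto the fat prisms at `c = α t`** (same radii: `fatRadius` has no centre argument).
[cite: KozmaNitzan2024, §4 p. 20 ((22)–(23))] -/
theorem image_frame_fatSeq [Countable V] {p : unitInterval} (hC : Φ.toPlanarSkeleton.CylSubcritical p) (i : ℕ) :
    (fatSeq Φ hC t i).image α = fatSeq Φ hC c i := by
  ext v
  rw [Finset.mem_image, mem_fatSeq_iff, ← image_cylBall_of_frame Φ hαt hφ i (fatRadius Φ hC i)]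
  constructor
  · rintro ⟨u, hu, rfl⟩
    exact ⟨u, (mem_fatSeq_iff Φ hC).1 hu, rfl⟩
  · rintro ⟨u, hu, rfl⟩
    exact ⟨u, (mem_fatSeq_iff Φ hC).2 hu, rfl⟩

/-- A frame carries the cylinder balls at `t` onto those at `c` (finset form). [folklore] -/
theorem image_frame_cylBallFin (k ρ : ℕ) : (cylBallFin Φ t k ρ).image α = cylBallFin Φ c k ρ := by
  ext v
  rw [Finset.mem_image, mem_cylBallFin, ← image_cylBall_of_frame Φ hαt hφ k ρ]
  constructor
  · rintro ⟨u, hu, rfl⟩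
    exact ⟨u, (mem_cylBallFin Φ).1 hu, rfl⟩
  · rintro ⟨u, hu, rfl⟩
    exact ⟨u, (mem_cylBallFin Φ).2 hu, rfl⟩

/-- **A frame carries the macro piece `g` at `t` onto the macro piece `g` at `c`** (relative skeleton coordinates are preserved).
[cite: KozmaNitzan2024, §4 p. 20 ((22)–(23))] -/
theorem image_frame_macroPiece (M R : ℕ) (g : HOct 2) : (macroPiece Φ t M R g).image α = macroPiece Φ c M R g := by
  ext v
  rw [macroPiece, macroPiece, Finset.mem_filter, ← image_frame_cylBallFin Φ hαt hφ M R, Finset.mem_image, Finset.mem_image]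
  constructor
  · rintro ⟨u, hu, rfl⟩
    rw [Finset.mem_filter] at hu
    refine ⟨⟨u, hu.1, rfl⟩, ?_⟩
    rw [hφ u, show Φ.φ u + (Φ.φ c - Φ.φ t) - Φ.φ c = Φ.φ u - Φ.φ t by abel]
    exact hu.2
  · rintro ⟨⟨u, hu, rfl⟩, hface⟩
    refine ⟨u, Finset.mem_filter.2 ⟨hu, ?_⟩, rfl⟩
    rw [hφ u, show Φ.φ u + (Φ.φ c - Φ.φ t) - Φ.φ c = Φ.φ u - Φ.φ t by abel] at hface
    exact hface

/-- **The inputs transported to the centre `c`**: the uniqueness-zone and the link probabilities of the fat prisms at `c` equal those at `t`.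
[cite: KozmaNitzan2024, §4 p. 20 ((22)–(23): lattice symmetries)] -/
theorem real_inputs_frame [Countable V] {p : unitInterval} (hC : Φ.toPlanarSkeleton.CylSubcritical p) (q : unitInterval) (msel M : ℕ)
    (g : HOct 2) :
    (bondPercolation G q).real (UniqZone.zone G (fatSeq Φ hC c) msel M) = (bondPercolation G q).real (UniqZone.zone G (fatSeq Φ hC t) msel M) ∧
    (bondPercolation G q).real (linkIn (↑(fatSeq Φ hC c M)) (fatSeq Φ hC c msel) (macroPiece Φ c M (fatRadius Φ hC M) g)) =
      (bondPercolation G q).real (linkIn (↑(fatSeq Φ hC t M)) (fatSeq Φ hC t msel) (macroPiece Φ t M (fatRadius Φ hC M) g)) := by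
  have hfun : (fun i => (fatSeq Φ hC t i).image α) = fatSeq Φ hC c := funext fun i => image_frame_fatSeq Φ hαt hφ hC i
  constructor
  · calc (bondPercolation G q).real (UniqZone.zone G (fatSeq Φ hC c) msel M)
        = (bondPercolation G q).real (UniqZone.zone G (fun i => (fatSeq Φ hC t i).image α) msel M) := by rw [hfun]
      _ = (bondPercolation G q).real (UniqZone.zone G (fatSeq Φ hC t) msel M) := real_zone_image_iso α q (fatSeq Φ hC t) msel M
  · calc (bondPercolation G q).real (linkIn (↑(fatSeq Φ hC c M)) (fatSeq Φ hC c msel) (macroPiece Φ c M (fatRadius Φ hC M) g))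
        = (bondPercolation G q).real (linkIn (↑((fatSeq Φ hC t M).image α)) ((fatSeq Φ hC t msel).image α)
            ((macroPiece Φ t M (fatRadius Φ hC M) g).image α)) := by
          rw [image_frame_fatSeq Φ hαt hφ hC, image_frame_fatSeq Φ hαt hφ hC, image_frame_macroPiece Φ hαt hφ]
      _ = (bondPercolation G q).real (linkIn (↑(fatSeq Φ hC t M)) (fatSeq Φ hC t msel) (macroPiece Φ t M (fatRadius Φ hC M) g)) :=
          real_linkIn_image_iso α q _ _ _

end Frame

/-- **The standard estimates at EVERY vertex** from the estimates at the base vertices (one frame per centre): if at the running parameter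
`q` every input event over `Φ.types × S` has probability `> 1 − δ`, then for every `M ∈ S` and every vertex `c` (framed to its type `t_c`
with inner size `msel t_c`) the zone and the eight links of the fat prisms AT `c` have probability `> 1 − δ`.
[cite: KozmaNitzan2024, §4 pp. 19–21 ((21)–(25): the inputs at a contact)] -/
theorem exists_inputs_at_center [Countable V] {p : unitInterval} (hC : Φ.toPlanarSkeleton.CylSubcritical p) (msel : V → ℕ)
    {S : Finset ℕ} {q : unitInterval} {δ : ℝ} (h : ∀ i ∈ inputIndex Φ S, 1 - δ < (bondPercolation G q).real (inputEvent Φ hC msel i))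
    {M : ℕ} (hM : M ∈ S) (c : V) :
    ∃ t ∈ Φ.types,
      1 - δ < (bondPercolation G q).real (UniqZone.zone G (fatSeq Φ hC c) (msel t) M) ∧
      ∀ g : HOct 2, 1 - δ < (bondPercolation G q).real
        (linkIn (↑(fatSeq Φ hC c M)) (fatSeq Φ hC c (msel t)) (macroPiece Φ c M (fatRadius Φ hC M) g)) := by
  obtain ⟨t, ht, α, hαt, hφ⟩ := Φ.frame c
  obtain ⟨hzone, hlink⟩ := hstd_of_inputs Φ hC msel h hM t ht
  refine ⟨t, ht, ?_, fun g => ?_⟩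
  · rw [(real_inputs_frame Φ hαt hφ hC q (msel t) M 1).1]; exact hzone
  · rw [(real_inputs_frame Φ hαt hφ hC q (msel t) M g).2]; exact hlink g

end Skel

end Transplant

end Summit.CriticalPhenomena.PercolationContinuityZ3.Theorems

end
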